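import Summits.QuantumFields.QCD.Theorems.NestedDissectionSeaCoerciveOfDilute
import Summits.QuantumFields.QCD.Theorems.NestedDissectionSeaKineticEdge
import Summits.QuantumFields.QCD.Theorems.NestedDissectionSeaSignDefectForcesCrossing

/-!
# Route `NestedDissectionSea`, support `CoerciveOfDilute` (stmt-QuantumFields-14759) —
# the leaf-scale freedom of the `∃`-alignment

`CoerciveOfDilute : NegativeCellsDilute → CoerciveSea` asks for clause (i) of the hinge (the
separator Wegner law in the window) ALONG a regularisation that also carries (ii) windowed local
dilution and (iii) the parity pin. The earlier files of this item
(`NestedDissectionSeaCoerciveOfDilute`, `…Subseq`, `…TwoLaws`) record the freedoms a supplier of (i)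
enjoys while keeping (ii)+(iii): enlarge the threshold `M₀` and the physical size `R`, shrink the
window `ℓ`, pass to a subsequence in `k`. The leaf size `b₀` was held RIGID there, because the leaf
clause of `IsSignDefect` is indexed by the dyadic scale (`j = 0`: the cell determinant is negative;
`j ≥ 1`: parent × sixteen children), so (ii) at leaf `b₀` says nothing about the leaf event at leaf
`2 b₀` — and the rigidity bites: with `b₀ = 2` the one-site box `(2,2,2,2)` is a window box of (i)
whose event is gauge-blind (`hasSingularSeparator_oneSiteBox_iff`), an exact exposure of every
`∀ reg` form of the law (`separatorLaw_false_of_pin_of_cluster_neg_four`).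

This file types the one remaining freedom, which the item's informal statement names ("re-derive
(ii) at the new leaf scale"): **the leaf may be doubled along any regularisation whose critical mass
stays above the kinetic floor of the new leaf boxes.** The mechanism is deterministic and already in
the tree: a leaf sign defect at bare mass `μ` forces a zero mode of the cell at some `μ' ≥ μ`
(`exists_det_wilsonCell_eq_zero_of_cellDetRe_neg`, the single-cell half of `SignDefectForcesCrossing`),
and a zero mode forces `Σ_i (1 − cos(π/s_i)) ≤ −μ'` (`kineticEdge_zeroMode`, `KineticEdge` (a)); the
new leaf boxes have sides `< 8 b₀`, hence kinetic floor `≥ 4 (1 − cos(π/(8 b₀)))`, so above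
`−4 (1 − cos(π/(8 b₀)))` they carry NO leaf defect for ANY gauge field, while every higher level of the
doubled hierarchy is a level of the old one with the IDENTICAL (product) event.

* `dilution_leafDoubling` — clause (ii) VERBATIM for `(reg, b₀, ℓ, m, R)` and
  `∀ᶠ k, −4(1 − cos(π/(8b₀))) < mcrit k` give clause (ii) VERBATIM for `(reg, 2 b₀, ℓ, m, R')`,
  `R' ≥ max R ℓ` (`δ'_j = δ_{j+1}`; the window depth drops by exactly one, `Nat.log_div_base`).
* `dilution_leafScaling` — iterated: leaf `2^r b₀` under `∀ᶠ k, −4(1 − cos(π/(2^{r+2} b₀))) < mcrit k`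
  (no condition for `r = 0`).
* helpers: `one_sub_cos_pi_div_antitone`, `kineticSum_ge_of_sides_le` (kinetic floor of boxes of
  bounded sides), `cellDetRe_nonneg_of_kineticFloor`, `not_isSignDefect_zero_of_kineticFloor` (no leaf
  defect above the floor, every field), `isSignDefect_succ_iff` (above the leaf the defect event does
  not see the scale index), `windowDepth_double`.

The USE is in the companion file `NestedDissectionSeaCoerciveOfDiluteLargeLeaf`
(`coerciveOfDilute_of_largeLeafWegnerLaw`: the separator Wegner law is needed only on boxes with all
sides `≥ 2^r b₀`, `r` at the supplier's choice under the margin; on the physical branch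
`mcrit k → 0⁻` every `r` qualifies, so no box of bounded lattice size — one-site, two-site,
single-plaquette — is ever in the law's scope at leaf `≥ 4`).

What this does NOT do: it does not prove the item (the law for large boxes is crux 13901 (i)); and
off the physical branch (a certified `reg` with `mcrit` clustering deep in `(−8, 0)`, not excluded by
(ii)+(iii) as typed) no margin is available and the leaf stays rigid — the case for the planner's
physical-branch guard recorded in `…Subseq`. Standard material. [folklore]
-/

noncomputable section

open scoped BigOperators Classical
open MeasureTheory Filter Matrix
open Literature.MathematicalPhysics.QuantumLattice Literature.MathematicalPhysics.QuantumFieldTheory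
  Literature.Probability.LatticeModels
open Summit.QuantumFields.QCD.Theses.NestedDissectionSea
open Summit.QuantumFields.QCD.Theorems.CoerciveSeaNegative
open Summit.QuantumFields.QCD.Theorems.NestedDissectionSea
  (exists_det_wilsonCell_eq_zero_of_cellDetRe_neg)
open Summit.QuantumFields.QCD.Theorems.KineticEdge (kineticEdge_zeroMode)

namespace Summit.QuantumFields.QCD.Theorems.NestedDissectionSeaCoerciveOfDilute

/-! ## 1. The kinetic floor of boxes of bounded sides -/

/-- `B ↦ 1 − cos(π/B)` is antitone on positive naturals: for `1 ≤ a ≤ b`,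
`1 − cos(π/b) ≤ 1 − cos(π/a)` (`π/b ≤ π/a ≤ π` and `cos` is antitone on `[0, π]`). [folklore] -/
theorem one_sub_cos_pi_div_antitone {a b : ℕ} (ha : 1 ≤ a) (hab : a ≤ b) :
    1 - Real.cos (Real.pi / b) ≤ 1 - Real.cos (Real.pi / a) := by
  have ha' : (0 : ℝ) < a := by exact_mod_cast ha
  have hb' : (0 : ℝ) < b := by exact_mod_cast lt_of_lt_of_le ha hab
  have hab' : (a : ℝ) ≤ b := by exact_mod_cast hab
  have h1 : Real.pi / b ≤ Real.pi / a := div_le_div_of_nonneg_left Real.pi_pos.le ha' hab'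
  have h2 : Real.pi / a ≤ Real.pi := div_le_self Real.pi_pos.le (by exact_mod_cast ha)
  have h3 : 0 ≤ Real.pi / b := div_nonneg Real.pi_pos.le hb'.le
  linarith [Real.cos_le_cos_of_nonneg_of_le_pi h3 h2 h1]

/-- **Kinetic floor of a box of bounded sides**: if `1 ≤ s_i ≤ B` for all `i` then
`4 (1 − cos(π/B)) ≤ Σ_i (1 − cos(π/s_i))`. [folklore] -/
theorem kineticSum_ge_of_sides_le {s : Fin 4 → ℕ} {B : ℕ} (hs : ∀ i, 1 ≤ s i ∧ s i ≤ B) :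
    4 * (1 - Real.cos (Real.pi / B)) ≤ ∑ i, (1 - Real.cos (Real.pi / s i)) := by
  calc 4 * (1 - Real.cos (Real.pi / B)) = ∑ _i : Fin 4, (1 - Real.cos (Real.pi / B)) := by
        rw [Finset.sum_const, Finset.card_univ, Fintype.card_fin, nsmul_eq_mul, Nat.cast_ofNat]
    _ ≤ ∑ i, (1 - Real.cos (Real.pi / s i)) :=
        Finset.sum_le_sum fun i _ => one_sub_cos_pi_div_antitone (hs i).1 (hs i).2

/-! ## 2. No leaf sign defect above the kinetic floor (KineticEdge (a) + the single-cell crossing lemma) -/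

section Cells

variable {N : ℕ} [NeZero N]

/-- **Dirichlet cell determinants are non-negative above the kinetic floor.** If the bare mass `μ`
exceeds `−Σ_i (1 − cos(π/s_i))` then `Re det D_c(U, μ, x, s) ≥ 0` for every `SU(3)` field and every
corner: a negative value would give a zero mode at some `μ' ≥ μ`
(`exists_det_wilsonCell_eq_zero_of_cellDetRe_neg`), against the kinetic edge
`Σ_i (1 − cos(π/s_i)) ≤ −μ'` (`kineticEdge_zeroMode`). [folklore] -/
theorem cellDetRe_nonneg_of_kineticFloor (U : GaugeConfig 4 N (Matrix.specialUnitaryGroup (Fin 3) ℂ))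
    {μ : ℝ} (x : TorusSite 4 N) {s : Fin 4 → ℕ} (hs : ∀ i, s i ≤ N)
    (hμ : -∑ i, (1 - Real.cos (Real.pi / s i)) < μ) : 0 ≤ cellDetRe U μ x s := by
  by_contra h
  obtain ⟨μ', hμμ', hdet⟩ := exists_det_wilsonCell_eq_zero_of_cellDetRe_neg U x s (not_le.mp h)
  have hedge := kineticEdge_zeroMode U s μ' x hs hdet
  linarith

/-- **No leaf sign defect above the kinetic floor**: for `μ > −Σ_i (1 − cos(π/s_i))` the corner-`0`
box of sides `s ≤ N` is not a sign defect at the leaf scale `j = 0`, for ANY gauge field. [folklore] -/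
theorem not_isSignDefect_zero_of_kineticFloor
    (U : GaugeConfig 4 N (Matrix.specialUnitaryGroup (Fin 3) ℂ)) {μ : ℝ} {s : Fin 4 → ℕ}
    (hs : ∀ i, s i ≤ N) (hμ : -∑ i, (1 - Real.cos (Real.pi / s i)) < μ) :
    ¬ IsSignDefect U μ 0 s := by
  rintro (⟨-, h⟩ | ⟨h, -⟩)
  · exact absurd h (not_lt.mpr (cellDetRe_nonneg_of_kineticFloor U 0 hs hμ))
  · exact absurd h (lt_irrefl 0)

/-- **Above the leaf scale the defect event does not see the scale index**: for `0 < j`,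
`IsSignDefect U μ (j + 1) s ↔ IsSignDefect U μ j s` (both are the parent × children sign-product
clause). [folklore] -/
theorem isSignDefect_succ_iff (U : GaugeConfig 4 N (Matrix.specialUnitaryGroup (Fin 3) ℂ)) (μ : ℝ)
    {j : ℕ} (hj : 0 < j) (s : Fin 4 → ℕ) :
    IsSignDefect U μ (j + 1) s ↔ IsSignDefect U μ j s := by
  have h1 : j ≠ 0 := hj.ne'
  simp only [IsSignDefect, h1, Nat.succ_ne_zero, false_and, false_or, hj, Nat.succ_pos', true_and]

end Cells

/-! ## 3. Window-depth arithmetic of the doubled leaf -/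

/-- Doubling the leaf lowers the window depth by exactly one, once the doubled leaf fits in the
window: `log₂(q/(2b₀)) + 1 + 1 = log₂(q/b₀) + 1` for `2 b₀ ≤ q` (`Nat.log_div_base`). [folklore] -/
theorem windowDepth_double {q b₀ : ℕ} (hb₀ : 0 < b₀) (hq : 2 * b₀ ≤ q) :
    Nat.log 2 (q / (2 * b₀)) + 1 + 1 = Nat.log 2 (q / b₀) + 1 := by
  have hdiv : q / (2 * b₀) = q / b₀ / 2 := by
    rw [Nat.div_div_eq_div_mul, mul_comm]
  have hq2 : 2 ≤ q / b₀ := (Nat.le_div_iff_mul_le hb₀).mpr hq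
  have hlog : 1 ≤ Nat.log 2 (q / b₀) := Nat.log_pos one_lt_two hq2
  rw [hdiv, Nat.log_div_base]
  omega

/-! ## 4. Leaf doubling of the dilution clause (ii) -/

/-- **LEAF DOUBLING of clause (ii).** Let the windowed local dilution clause of
`NegativeCellsDilute` / `CoerciveSea` hold VERBATIM for `(reg, b₀, ℓ, m, R)` (`b₀ ≥ 2`, `m ≥ 0`), and
let the critical mass eventually exceed the kinetic floor of boxes of sides `< 8 b₀`:
`∀ᶠ k, −4(1 − cos(π/(8 b₀))) < mcrit k`. Then the same clause holds VERBATIM for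
`(reg, 2 b₀, ℓ, m, R')` for every `R' ≥ max R ℓ`. Proof: eventually `2 b₀ a_k < ℓ`, so the window
depth at leaf `2 b₀` is `J − 1` (`windowDepth_double`) and, on tori of physical side `≥ ℓ`, every
`δ_j` of the hypothesis (`j < J`) dominates a genuine probability (`scaleBox_admissible`) and is `≥ 0`;
put `δ'_j := δ_{j+1}`: `Σ_{j<J−1} δ'_j = Σ_{j<J} δ_j − δ_0 ≤ ε`; a level-`j` box of the doubled
hierarchy with `j ≥ 1` is a level-`(j+1)` box of the old one with the same event
(`isSignDefect_succ_iff`); at the new leaf level `j = 0` the boxes have sides in `[2b₀, 8b₀)`, the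
valence masses `mcrit k + a_k m_f/Z_m k ≥ mcrit k` lie above their kinetic floor, so the event is
EMPTY for every field (`not_isSignDefect_zero_of_kineticFloor`) and its ratio is `0 ≤ δ_1`. [folklore] -/
theorem dilution_leafDoubling {Nf : ℕ} (reg : QCDRegularisation Nf) {b₀ : ℕ} (hb₀ : 2 ≤ b₀)
    {ℓ R R' : ℝ} (hℓ : 0 < ℓ) (hRR : R ≤ R') (hℓR : ℓ ≤ R') (m : Fin Nf → ℝ) (hm : ∀ f, 0 ≤ m f)
    (hμ : ∀ᶠ k : ℕ in Filter.atTop, -(4 * (1 - Real.cos (Real.pi / (8 * (b₀ : ℝ))))) < reg.mcrit k)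
    (h : ∀ ε : ℝ, 0 < ε → ∀ᶠ k : ℕ in Filter.atTop, ∀ S : ℕ, R ≤ reg.a k * (2 * S + 1) → let N : ℕ := 2 * S + 1; let mq : Fin Nf → ℝ := fun f => reg.mcrit k + reg.a k * m f / reg.Zm k; let wt : GaugeConfig 4 N (Matrix.specialUnitaryGroup (Fin 3) ℂ) → ℝ := fun U => ∏ f, ‖fermionDet (wilsonDirac (fundamentalRep (Fin 3)) U (mq f) 1)‖; let P : (GaugeConfig 4 N (Matrix.specialUnitaryGroup (Fin 3) ℂ) → Prop) → ℝ := fun E => (∫ U, (if E U then (1 : ℝ) else 0) * wt U ∂(wilsonMeasure (d := 4) (L := N) (fundamentalRep (Fin 3)) (reg.β k))) / (∫ U, wt U ∂(wilsonMeasure (d := 4) (L := N) (fundamentalRep (Fin 3)) (reg.β k))); let J : ℕ := Nat.log 2 (⌊ℓ / reg.a k⌋₊ / b₀) + 1; ∃ δ : ℕ → ℝ, ∑ j ∈ Finset.range J, δ j ≤ ε ∧ ∀ j < J, ∀ s : Fin 4 → ℕ, (∀ i, b₀ * 2 ^ j ≤ s i ∧ s i < b₀ * 2 ^ (j + 2)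 ∧ s i ≤ N ∧ (s i : ℝ) * reg.a k ≤ ℓ) → P (fun U => ∃ f, IsSignDefect U (mq f) j s) ≤ δ j) :
    ∀ ε : ℝ, 0 < ε → ∀ᶠ k : ℕ in Filter.atTop, ∀ S : ℕ, R' ≤ reg.a k * (2 * S + 1) → let N : ℕ := 2 * S + 1; let mq : Fin Nf → ℝ := fun f => reg.mcrit k + reg.a k * m f / reg.Zm k; let wt : GaugeConfig 4 N (Matrix.specialUnitaryGroup (Fin 3) ℂ) → ℝ := fun U => ∏ f, ‖fermionDet (wilsonDirac (fundamentalRep (Fin 3)) U (mq f) 1)‖; let P : (GaugeConfig 4 N (Matrix.specialUnitaryGroup (Fin 3) ℂ) → Prop) → ℝ := fun E => (∫ U, (if E U then (1 : ℝ) else 0) * wt U ∂(wilsonMeasure (d := 4) (L := N) (fundamentalRep (Fin 3)) (reg.β k))) / (∫ U, wt U ∂(wilsonMeasure (d := 4) (L := N) (fundamentalRep (Fin 3)) (reg.β k))); let J : ℕ := Nat.log 2 (⌊ℓ / reg.a k⌋₊ / (2 * b₀)) + 1; ∃ δ : ℕ → ℝ, ∑ j ∈ Finset.range J, δ j ≤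 ε ∧ ∀ j < J, ∀ s : Fin 4 → ℕ, (∀ i, 2 * b₀ * 2 ^ j ≤ s i ∧ s i < 2 * b₀ * 2 ^ (j + 2) ∧ s i ≤ N ∧ (s i : ℝ) * reg.a k ≤ ℓ) → P (fun U => ∃ f, IsSignDefect U (mq f) j s) ≤ δ j := by
  intro ε hε
  have hb₀pos : 0 < b₀ := lt_of_lt_of_le (by norm_num) hb₀
  have hb₀real : (0 : ℝ) < b₀ := by exact_mod_cast hb₀pos
  have h2b₀real : (0 : ℝ) < 2 * b₀ := by positivity
  -- eventually the doubled leaf fits in the window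
  have hsmall : ∀ᶠ k : ℕ in Filter.atTop, reg.a k < ℓ / (2 * b₀) :=
    reg.tendsto_a.eventually (gt_mem_nhds (div_pos hℓ h2b₀real))
  filter_upwards [h ε hε, hsmall, hμ] with k hk hak hμk
  intro S hS
  have ha := reg.a_pos k
  have hk' := hk S (hRR.trans hS)
  dsimp only at hk' ⊢
  obtain ⟨δ, hsum, hδ⟩ := hk'
  -- window arithmetic
  have h2bℓ : 2 * (b₀ : ℝ) * reg.a k ≤ ℓ := by
    have h1 : reg.a k * (2 * b₀) < ℓ := (lt_div_iff₀ h2b₀real).mp hak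
    nlinarith
  have hbℓ : (b₀ : ℝ) * reg.a k ≤ ℓ := by nlinarith
  have hN : ℓ ≤ reg.a k * ((2 * S + 1 : ℕ) : ℝ) := by
    push_cast
    exact hℓR.trans hS
  have hq : 2 * b₀ ≤ ⌊ℓ / reg.a k⌋₊ := by
    refine Nat.le_floor ?_
    rw [le_div_iff₀ ha]
    push_cast
    exact h2bℓ
  have hJ := windowDepth_double hb₀pos hq
  set J₂ : ℕ := Nat.log 2 (⌊ℓ / reg.a k⌋₊ / (2 * b₀)) + 1 with hJ₂
  rw [← hJ] at hsum hδ
  -- every `δ j`, `j < J`, dominates a genuine probability and is `≥ 0`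
  have hδnonneg : ∀ j < J₂ + 1, 0 ≤ δ j := by
    intro j hj
    have hj' : j < Nat.log 2 (⌊ℓ / reg.a k⌋₊ / b₀) + 1 := by rwa [← hJ]
    obtain ⟨hlt, hle, hwin⟩ := scaleBox_admissible ha hb₀pos hbℓ hN hj'
    have hbox := hδ j hj (fun _ => b₀ * 2 ^ j) fun i => ⟨le_rfl, hlt, hle, hwin⟩
    exact le_trans (quenchedRatio_nonneg _ (fun U => Finset.prod_nonneg fun f _ => norm_nonneg _) _)
      hbox
  refine ⟨fun j => δ (j + 1), ?_, ?_⟩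
  · -- the shifted sum drops `δ 0 ≥ 0`
    have hsplit := Finset.sum_range_succ' δ J₂
    have h0 : 0 ≤ δ 0 := hδnonneg 0 (Nat.succ_pos _)
    linarith
  · intro j hj s hs
    rcases Nat.eq_zero_or_pos j with rfl | hjpos
    · -- the new leaf level: no leaf defect above the kinetic floor, the event is empty
      have hsN : ∀ i, s i ≤ 2 * S + 1 := fun i => (hs i).2.2.1
      have hsB : ∀ i, 1 ≤ s i ∧ s i ≤ 8 * b₀ := fun i => by
        have h1 := (hs i).1
        have h2 := (hs i).2.1
        constructor
        · calc 1 ≤ 2 * b₀ * 2 ^ 0 := by simpa using by omega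
            _ ≤ s i := h1
        · have : 2 * b₀ * 2 ^ (0 + 2) = 8 * b₀ := by ring
          omega
      have hfloor := kineticSum_ge_of_sides_le hsB
      have hcast : ((8 * b₀ : ℕ) : ℝ) = 8 * (b₀ : ℝ) := by push_cast; ring
      rw [hcast] at hfloor
      have hempty : ∀ U : GaugeConfig 4 (2 * S + 1) (Matrix.specialUnitaryGroup (Fin 3) ℂ),
          ¬ ∃ f, IsSignDefect U (reg.mcrit k + reg.a k * m f / reg.Zm k) 0 s := by
        rintro U ⟨f, hf⟩
        refine not_isSignDefect_zero_of_kineticFloor U hsN ?_ hf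
        have hoff : 0 ≤ reg.a k * m f / reg.Zm k :=
          div_nonneg (mul_nonneg ha.le (hm f)) (reg.Zm_pos k).le
        linarith
      simp only [hempty, if_false, zero_mul, integral_zero, zero_div]
      exact hδnonneg _ (by omega)
    · -- higher levels: a level-`j` box of the doubled hierarchy is a level-`(j+1)` box of the old
      have e1 : 2 * b₀ * 2 ^ j = b₀ * 2 ^ (j + 1) := by ring
      have e2 : 2 * b₀ * 2 ^ (j + 2) = b₀ * 2 ^ (j + 1 + 2) := by ring
      have hs1 : ∀ i, b₀ * 2 ^ (j + 1) ≤ s i ∧ s i < b₀ * 2 ^ (j + 1 + 2) ∧ s i ≤ 2 * S + 1 ∧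
          (s i : ℝ) * reg.a k ≤ ℓ := fun i =>
        ⟨e1.symm.le.trans (hs i).1, (hs i).2.1.trans_eq e2, (hs i).2.2.1, (hs i).2.2.2⟩
      have key := hδ (j + 1) (by omega) s hs1
      convert key using 6
      simp only [isSignDefect_succ_iff _ _ hjpos]

/-- **LEAF SCALING of clause (ii)** (`dilution_leafDoubling` iterated): clause (ii) VERBATIM for
`(reg, b₀, ℓ, m, R)` and, when `r ≥ 1`, `∀ᶠ k, −4(1 − cos(π/(2^{r+2} b₀))) < mcrit k` (the kinetic
floor of the largest new leaf boxes, sides `< 2^{r+2} b₀`; it implies the margins of all intermediate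
doublings) give clause (ii) VERBATIM for `(reg, 2^r b₀, ℓ, m, R')`, `R' ≥ max R ℓ`. [folklore] -/
theorem dilution_leafScaling {Nf : ℕ} (reg : QCDRegularisation Nf) {b₀ : ℕ} (hb₀ : 2 ≤ b₀) (r : ℕ)
    {ℓ R R' : ℝ} (hℓ : 0 < ℓ) (hRR : R ≤ R') (hℓR : ℓ ≤ R') (m : Fin Nf → ℝ) (hm : ∀ f, 0 ≤ m f)
    (hμ : r ≠ 0 → ∀ᶠ k : ℕ in Filter.atTop,
      -(4 * (1 - Real.cos (Real.pi / (2 ^ (r + 2) * (b₀ : ℝ))))) < reg.mcrit k)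
    (h : ∀ ε : ℝ, 0 < ε → ∀ᶠ k : ℕ in Filter.atTop, ∀ S : ℕ, R ≤ reg.a k * (2 * S + 1) → let N : ℕ := 2 * S + 1; let mq : Fin Nf → ℝ := fun f => reg.mcrit k + reg.a k * m f / reg.Zm k; let wt : GaugeConfig 4 N (Matrix.specialUnitaryGroup (Fin 3) ℂ) → ℝ := fun U => ∏ f, ‖fermionDet (wilsonDirac (fundamentalRep (Fin 3)) U (mq f) 1)‖; let P : (GaugeConfig 4 N (Matrix.specialUnitaryGroup (Fin 3) ℂ) → Prop) → ℝ := fun E => (∫ U, (if E U then (1 : ℝ) else 0) * wt U ∂(wilsonMeasure (d := 4) (L := N) (fundamentalRep (Fin 3)) (reg.β k))) / (∫ U, wt U ∂(wilsonMeasure (d := 4) (L := N) (fundamentalRep (Fin 3)) (reg.β k))); let J : ℕ := Nat.log 2 (⌊ℓ / reg.a k⌋₊ / b₀) + 1; ∃ δ : ℕ → ℝ, ∑ j ∈ Finset.range J, δ j ≤ ε ∧ ∀ j < J, ∀ s : Fin 4 → ℕ, (∀ i, b₀ * 2 ^ j ≤ s i ∧ s i < b₀ * 2 ^ (j + 2)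 ∧ s i ≤ N ∧ (s i : ℝ) * reg.a k ≤ ℓ) → P (fun U => ∃ f, IsSignDefect U (mq f) j s) ≤ δ j) :
    ∀ ε : ℝ, 0 < ε → ∀ᶠ k : ℕ in Filter.atTop, ∀ S : ℕ, R' ≤ reg.a k * (2 * S + 1) → let N : ℕ := 2 * S + 1; let mq : Fin Nf → ℝ := fun f => reg.mcrit k + reg.a k * m f / reg.Zm k; let wt : GaugeConfig 4 N (Matrix.specialUnitaryGroup (Fin 3) ℂ) → ℝ := fun U => ∏ f, ‖fermionDet (wilsonDirac (fundamentalRep (Fin 3)) U (mq f) 1)‖; let P : (GaugeConfig 4 N (Matrix.specialUnitaryGroup (Fin 3) ℂ) → Prop) → ℝ := fun E => (∫ U, (if E U then (1 : ℝ) else 0) * wt U ∂(wilsonMeasure (d := 4) (L := N) (fundamentalRep (Fin 3)) (reg.β k))) / (∫ U, wt U ∂(wilsonMeasure (d := 4) (L := N) (fundamentalRep (Fin 3)) (reg.β k))); let J : ℕ := Nat.log 2 (⌊ℓ / reg.a k⌋₊ / (2 ^ r * b₀)) + 1; ∃ δ : ℕ → ℝ, ∑ j ∈ Finset.range J, δ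 j ≤ ε ∧ ∀ j < J, ∀ s : Fin 4 → ℕ, (∀ i, 2 ^ r * b₀ * 2 ^ j ≤ s i ∧ s i < 2 ^ r * b₀ * 2 ^ (j + 2) ∧ s i ≤ N ∧ (s i : ℝ) * reg.a k ≤ ℓ) → P (fun U => ∃ f, IsSignDefect U (mq f) j s) ≤ δ j := by
  induction r with
  | zero =>
    simp only [pow_zero, one_mul]
    exact dilution_mono reg hb₀ hℓ le_rfl hRR hℓR m h
  | succ r ih =>
    -- the margin of the last doubling implies the margins of the earlier ones
    have hb₀real : (0 : ℝ) < b₀ := by exact_mod_cast lt_of_lt_of_le (by norm_num) hb₀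
    have hμ' := hμ (Nat.succ_ne_zero r)
    have ih' := ih (fun hr => by
      filter_upwards [hμ'] with k hk
      have hmono : 1 - Real.cos (Real.pi / (2 ^ (r + 1 + 2) * (b₀ : ℝ))) ≤
          1 - Real.cos (Real.pi / (2 ^ (r + 2) * (b₀ : ℝ))) := by
        have := one_sub_cos_pi_div_antitone (a := 2 ^ (r + 2) * b₀) (b := 2 ^ (r + 1 + 2) * b₀)
          (Nat.one_le_iff_ne_zero.mpr (by positivity))
          (Nat.mul_le_mul_right b₀ (Nat.pow_le_pow_right (by norm_num) (by omega)))
        push_cast at this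
        exact this
      linarith)
    -- double the leaf `2^r b₀`
    have hb₀r : 2 ≤ 2 ^ r * b₀ := le_trans hb₀ (Nat.le_mul_of_pos_left b₀ (by positivity))
    have hd := dilution_leafDoubling reg hb₀r hℓ (le_refl R') ((le_max_right R ℓ).trans
      (max_le hRR hℓR)) m hm (by
        filter_upwards [hμ'] with k hk
        have hcast : (8 : ℝ) * ((2 ^ r * b₀ : ℕ) : ℝ) = 2 ^ (r + 1 + 2) * (b₀ : ℝ) := by
          push_cast; ring
        rwa [hcast]) ih'
    have e : 2 * (2 ^ r * b₀) = 2 ^ (r + 1) * b₀ := by ring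
    rw [e] at hd
    exact hd

end Summit.QuantumFields.QCD.Theorems.NestedDissectionSeaCoerciveOfDilute

end
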